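import Mathlib.Data.Real.Sign
import Literature.Computability.QuantumComplexity.ForrelationDerivativeTables

/-!
# `CubicForrelationInPrBPP` — negative knowledge: the SIGNED slice is invisible to the Φ²-engine

Support file for crux `stmt-QuantumAdvantage-2204`
(`Summit.QuantumAdvantage.QuantumAdvantage.Theses.CubicForrelation.CubicForrelationInPrBPP`, route
`QuantumAdvantage/CubicForrelation`), written by the standing disprover
refuter-cdisprove-stmt-QuantumAdvantage-2204-g2-0 (2026-08-15). The crux (cubic 2-fold Forrelation
`CF₂ ∈ PromiseBPP'`) is true on paper via the derivative-Walsh-table identity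
`2^{3n} Φ² = ∑ T_f(h,u) T_g(u,h)` (`ForrelationDerivativeTables.lean`). This file records, as
theorems, WHY that engine proves nothing about the natural SIGNED strengthening (`Φ ≥ 3/5` vs
`Φ ≤ -3/5`, resp. the exact slice `Φ = 1` vs `Φ = -1`) — the planner's announced k = 2 restatement:

* `signed_slice_defeats_table_deciders`: no decider factoring through the pair of tables `(T_f, T_g)`
  separates the signed promise, uniformly or not in `n` (witness `n = 2`: `(x₀x₁, x₀x₁)` has `Φ = 1`,
  `(x₀x₁, ¬x₀x₁)` has `Φ = -1`, equal tables);
* `forrelation_mul_bias_eq`, `forrelation_eq_sign_mul_sign_bias`: on the exact slice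
  `Φ · ∑_x (-1)^{f(x)} = 2^{n/2} (-1)^{g(0)}`, so `Φ = (-1)^{g(0)} · sgn(∑_x (-1)^{f(x)})` — the signed
  exact slice IS the sign of the bias of a cubic bent function (given its dual up to complement);
* the Walsh toolkit behind it over `DerivativeWalsh.W`: Parseval `sum_W_sq_of_sq`, inversion
  `sum_W_mul_twist` / `sum_W`, and the rigidity of exact pairs `W_eq_of_fsum_sq`
  (`S² = 8ⁿ ⇒ W_g = (S/2ⁿ)·f` pointwise: `g` bent, `f = ±` its dual), `fsum_mul_bias_eq`.

All proofs are from scratch over the tree's `forrelation`, `twist`, `signOf`, `dwt`, `W`, `fsum`.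

## References

* [AaronsonAmbainis2018] S. Aaronson, A. Ambainis, Forrelation, SIAM J. Comput. 47 (2018), §1.1.1.
* [ODonnell2014] R. O'Donnell, Analysis of Boolean Functions (2014), §1.4 (Parseval, inversion).
* C. Carlet, Boolean Functions for Cryptography and Coding Theory, CUP 2021, §6.1 (bent functions,
  duals) — orientation only.
-/

noncomputable section

namespace Summit.QuantumAdvantage.QuantumAdvantage.Theorems.CubicForrelationInPrBPP.Negative

open Finset
open Literature.Computability.QuantumComplexity
open Literature.Computability.QuantumComplexity.BuzetChailloux (bxor zeroVec twist_bxor_right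
  sum_twist_left bxor_eq_zeroVec_iff twist_zeroVec_right signOf_sq phi_signOf)
open Literature.Computability.QuantumComplexity.DerivativeWalsh

/-! ### Walsh toolkit over the tree's `DerivativeWalsh.W` (unnormalised transform) -/

section Walsh

variable {n : ℕ}

/-- Parseval for a `±1`-valued function: `∑_x W_g(x)² = 2ⁿ·2ⁿ`. [folklore] -/
theorem sum_W_sq_of_sq (g : (Fin n → Bool) → ℝ) (hg : ∀ y, g y ^ 2 = 1) :
    ∑ x, W g x ^ 2 = (2 : ℝ) ^ n * 2 ^ n := by
  have e1 : ∀ x : Fin n → Bool, W g x ^ 2 = ∑ y, ∑ y', g y * g y' * twist x (bxor y y') := by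
    intro x
    rw [W, sq, sum_mul_sum]
    refine sum_congr rfl fun y _ => sum_congr rfl fun y' _ => ?_
    rw [twist_bxor_right, twist_comm y x, twist_comm y' x]
    ring
  rw [sum_congr rfl fun x _ => e1 x, sum_comm]
  have e2 : ∀ y : Fin n → Bool, ∑ x, ∑ y', g y * g y' * twist x (bxor y y') = (2 : ℝ) ^ n * g y ^ 2 := by
    intro y
    rw [sum_comm]
    have e3 : ∀ y' : Fin n → Bool, ∑ x, g y * g y' * twist x (bxor y y') =
        g y * g y' * (if bxor y y' = zeroVec then (2 : ℝ) ^ n else 0) := by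
      intro y'
      rw [← sum_twist_left, mul_sum]
    rw [sum_congr rfl fun y' _ => e3 y']
    simp_rw [bxor_eq_zeroVec_iff, mul_ite, mul_zero]
    rw [Finset.sum_ite_eq univ y, if_pos (mem_univ _)]
    ring
  rw [sum_congr rfl fun y _ => e2 y, ← mul_sum]
  simp_rw [hg, sum_const, card_univ, Fintype.card_fun, Fintype.card_bool, Fintype.card_fin,
    nsmul_eq_mul, mul_one]
  push_cast
  ring

/-- Fourier inversion: `∑_x W_g(x) (-1)^{x·y} = 2ⁿ g(y)`. [folklore] -/
theorem sum_W_mul_twist (g : (Fin n → Bool) → ℝ) (y : Fin n → Bool) :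
    ∑ x, W g x * twist x y = (2 : ℝ) ^ n * g y := by
  have e1 : ∀ x : Fin n → Bool, W g x * twist x y = ∑ z, g z * twist x (bxor z y) := by
    intro x
    rw [W, sum_mul]
    refine sum_congr rfl fun z _ => ?_
    rw [twist_bxor_right, twist_comm z x]
    ring
  rw [sum_congr rfl fun x _ => e1 x, sum_comm]
  have e2 : ∀ z : Fin n → Bool, ∑ x, g z * twist x (bxor z y) =
      g z * (if bxor z y = zeroVec then (2 : ℝ) ^ n else 0) := by
    intro z
    rw [← sum_twist_left, mul_sum]
  rw [sum_congr rfl fun z _ => e2 z]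
  simp_rw [bxor_eq_zeroVec_iff, mul_ite, mul_zero]
  rw [Finset.sum_ite_eq' univ y, if_pos (mem_univ _)]
  ring

/-- `∑_x W_g(x) = 2ⁿ g(0)`. [folklore] -/
theorem sum_W (g : (Fin n → Bool) → ℝ) : ∑ x, W g x = (2 : ℝ) ^ n * g zeroVec := by
  rw [← sum_W_mul_twist g zeroVec]
  exact sum_congr rfl fun x _ => by rw [twist_zeroVec_right, mul_one]

/-- **Rigidity of exact pairs.** For `±1`-valued `f, g` with `S(f,g)² = 8ⁿ` (i.e. `Φ = ±1`), the
Walsh transform of `g` is `(S/2ⁿ) · f` pointwise — `g` is bent and `f` is `±` its dual. Proof: the sum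
of squares `∑_x (W_g(x) - (S/2ⁿ) f(x))²` vanishes by Parseval. [folklore] -/
theorem W_eq_of_fsum_sq (f g : (Fin n → Bool) → ℝ) (hf : ∀ x, f x ^ 2 = 1) (hg : ∀ y, g y ^ 2 = 1)
    (hS : fsum f g ^ 2 = (8 : ℝ) ^ n) (x : Fin n → Bool) :
    W g x = fsum f g / 2 ^ n * f x := by
  set c : ℝ := fsum f g / 2 ^ n with hc
  have h2n : (2 : ℝ) ^ n ≠ 0 := pow_ne_zero _ two_ne_zero
  have hsum : ∑ x, (W g x - c * f x) ^ 2 = 0 := by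
    have e : ∀ x : Fin n → Bool, (W g x - c * f x) ^ 2 =
        W g x ^ 2 - 2 * c * (f x * W g x) + c ^ 2 * f x ^ 2 := fun x => by ring
    simp_rw [e, sum_add_distrib, sum_sub_distrib, ← mul_sum, sum_W_sq_of_sq g hg,
      ← fsum_eq_sum_mul_W, hf, sum_const, card_univ, Fintype.card_fun, Fintype.card_bool,
      Fintype.card_fin, nsmul_eq_mul, mul_one]
    push_cast
    have h8 : (8 : ℝ) ^ n = 2 ^ n * 2 ^ n * 2 ^ n := by
      rw [← mul_pow, ← mul_pow]; norm_num
    rw [hc]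
    field_simp
    rw [h8] at hS
    nlinarith [hS]
  have hx := (sum_eq_zero_iff_of_nonneg fun x _ => sq_nonneg _).1 hsum x (mem_univ _)
  have : W g x - c * f x = 0 := pow_eq_zero_iff (n := 2) (by norm_num) |>.1 hx
  linarith

/-- **Sign of an exact forrelation = value of `g` at `0` × sign of the bias of `f`**:
`S(f,g) · ∑_x f(x) = 4ⁿ · g(0)` whenever `S² = 8ⁿ`. [folklore] -/
theorem fsum_mul_bias_eq (f g : (Fin n → Bool) → ℝ) (hf : ∀ x, f x ^ 2 = 1) (hg : ∀ y, g y ^ 2 = 1)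
    (hS : fsum f g ^ 2 = (8 : ℝ) ^ n) :
    fsum f g * ∑ x, f x = (2 : ℝ) ^ n * 2 ^ n * g zeroVec := by
  have h2n : (2 : ℝ) ^ n ≠ 0 := pow_ne_zero _ two_ne_zero
  have h1 : ∑ x, W g x = fsum f g / 2 ^ n * ∑ x, f x := by
    rw [mul_sum]
    exact sum_congr rfl fun x _ => W_eq_of_fsum_sq f g hf hg hS x
  rw [sum_W] at h1
  field_simp at h1
  linarith [h1]

end Walsh

/-! ### The exact slice over the tree's `forrelation` -/

section Exact

variable {n : ℕ}

/-- `√(2^{3n}) = √(2ⁿ) · 2ⁿ`. [folklore] -/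
theorem sqrt_eight_pow (n : ℕ) :
    Real.sqrt ((2 : ℝ) ^ (3 * n)) = Real.sqrt ((2 : ℝ) ^ n) * 2 ^ n := by
  rw [show (2 : ℝ) ^ (3 * n) = 2 ^ n * (2 ^ n) ^ 2 by ring, Real.sqrt_mul (by positivity),
    Real.sqrt_sq (by positivity)]

/-- **`Φ · bias(f) = 2^{n/2} · (-1)^{g(0)}` on the exact slice.** For Boolean `f, g` with
`Φ(f,g)² = 1`: `forrelation f g * ∑_x (-1)^{f x} = √(2ⁿ) · (-1)^{g 0}`. Hence the SIGN of an exact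
forrelation is `(-1)^{g(0)} · sgn(∑_x (-1)^{f(x)})`: deciding the signed exact slice `Φ = 1` vs
`Φ = -1` for cubic pairs is exactly computing the sign of the bias of a cubic bent function (whose
dual is known up to complement). [folklore] -/
theorem forrelation_mul_bias_eq (f g : (Fin n → Bool) → Bool) (hΦ : forrelation f g ^ 2 = 1) :
    forrelation f g * ∑ x, signOf (f x) = Real.sqrt ((2 : ℝ) ^ n) * signOf (g zeroVec) := by
  have hf : ∀ x, (fun x => signOf (f x)) x ^ 2 = 1 := fun x => signOf_sq (f x)
  have hg : ∀ y, (fun y => signOf (g y)) y ^ 2 = 1 := fun y => signOf_sq (g y)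
  have key := two_pow_mul_forrelation_sq f g
  rw [hΦ, mul_one, sum_dwt_mul_dwt] at key
  have hS : fsum (fun x => signOf (f x)) (fun y => signOf (g y)) ^ 2 = (8 : ℝ) ^ n := by
    rw [← key, pow_mul]; norm_num
  have hb := fsum_mul_bias_eq _ _ hf hg hS
  -- forrelation = fsum / √(2^{3n})
  have hrel : forrelation f g = (Real.sqrt ((2 : ℝ) ^ (3 * n)))⁻¹ *
      fsum (fun x => signOf (f x)) (fun y => signOf (g y)) := by
    rw [← phi_signOf, phi_eq_fsum]
  have hsq : Real.sqrt ((2 : ℝ) ^ n) ≠ 0 := (Real.sqrt_pos.2 (by positivity)).ne'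
  have h2n : (2 : ℝ) ^ n ≠ 0 := pow_ne_zero _ two_ne_zero
  have hss : Real.sqrt ((2 : ℝ) ^ n) * Real.sqrt ((2 : ℝ) ^ n) = 2 ^ n :=
    Real.mul_self_sqrt (by positivity)
  rw [hrel, sqrt_eight_pow, mul_assoc, hb, inv_mul_eq_iff_eq_mul₀ (mul_ne_zero hsq h2n)]
  rw [show Real.sqrt ((2 : ℝ) ^ n) * 2 ^ n * (Real.sqrt ((2 : ℝ) ^ n) * signOf (g zeroVec)) =
      Real.sqrt ((2 : ℝ) ^ n) * Real.sqrt ((2 : ℝ) ^ n) * 2 ^ n * signOf (g zeroVec) by ring, hss]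

/-- The sign form: on the exact slice `Φ = (-1)^{g(0)} · sgn(∑_x (-1)^{f(x)})` (and the bias of `f`
is non-zero, indeed `= ± 2^{n/2}`). [folklore] -/
theorem forrelation_eq_sign_mul_sign_bias (f g : (Fin n → Bool) → Bool) (hΦ : forrelation f g ^ 2 = 1) :
    forrelation f g = signOf (g zeroVec) * Real.sign (∑ x, signOf (f x)) := by
  have h := forrelation_mul_bias_eq f g hΦ
  have hsq : 0 < Real.sqrt ((2 : ℝ) ^ n) := Real.sqrt_pos.2 (by positivity)
  have hΦ' : forrelation f g = 1 ∨ forrelation f g = -1 := by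
    have hm : (forrelation f g - 1) * (forrelation f g + 1) = 0 := by ring_nf; linarith [hΦ]
    rcases mul_eq_zero.1 hm with h1 | h1
    · exact Or.inl (by linarith)
    · exact Or.inr (by linarith)
  have hg0 : signOf (g zeroVec) = 1 ∨ signOf (g zeroVec) = -1 := by
    cases g zeroVec <;> simp [signOf]
  rcases hΦ' with h1 | h1 <;> rcases hg0 with h2 | h2 <;> rw [h1, h2] at h ⊢
  · have : 0 < ∑ x, signOf (f x) := by nlinarith
    rw [Real.sign_of_pos this]; ring
  · have : ∑ x, signOf (f x) < 0 := by nlinarith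
    rw [Real.sign_of_neg this]; ring
  · have : ∑ x, signOf (f x) < 0 := by nlinarith
    rw [Real.sign_of_neg this]; ring
  · have : 0 < ∑ x, signOf (f x) := by nlinarith
    rw [Real.sign_of_pos this]; ring

end Exact

/-! ### The Φ²/derivative-table engine cannot decide the SIGNED slice -/

/-- `Φ(x₀x₁, x₀x₁) = 1` on two bits (the tree's `andPairInstance_value`, transported). [folklore] -/
theorem forrelation_and_and : forrelation (n := 2) andTwoCircuit.eval andTwoCircuit.eval = 1 := by
  have h := andPairInstance_value
  rwa [show andPairInstance = ⟨2, 2, fun _ => andTwoCircuit⟩ from rfl,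
    KForrelationInstance.value_mk_two] at h

/-- `¬(x₀ ∧ x₁) = [1 + x₀x₁ = 1]` has algebraic degree `≤ 3`. [folklore] -/
theorem isDegLeFun_not_and : IsDegLeFun 3 (fun y : Fin 2 → Bool => !(andTwoCircuit.eval y)) := by
  refine ⟨1 + MvPolynomial.X 0 * MvPolynomial.X 1, ?_, fun x => ?_⟩
  · calc (1 + MvPolynomial.X 0 * MvPolynomial.X 1 : MvPolynomial (Fin 2) (ZMod 2)).totalDegree
          ≤ max (1 : MvPolynomial (Fin 2) (ZMod 2)).totalDegree
              (MvPolynomial.X 0 * MvPolynomial.X 1 : MvPolynomial (Fin 2) (ZMod 2)).totalDegree :=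
            MvPolynomial.totalDegree_add _ _
      _ ≤ 3 := by
            refine max_le (by simp) ?_
            calc (MvPolynomial.X 0 * MvPolynomial.X 1 : MvPolynomial (Fin 2) (ZMod 2)).totalDegree
                ≤ (MvPolynomial.X 0 : MvPolynomial (Fin 2) (ZMod 2)).totalDegree +
                    (MvPolynomial.X 1 : MvPolynomial (Fin 2) (ZMod 2)).totalDegree :=
                  MvPolynomial.totalDegree_mul _ _
              _ ≤ 1 + 1 := add_le_add (MvPolynomial.totalDegree_X (R := ZMod 2) _).le
                    (MvPolynomial.totalDegree_X (R := ZMod 2) _).le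
              _ ≤ 3 := by norm_num
  · show (!(andTwoCircuit.eval x)) = polyPhase _ x
    rw [andTwoCircuit_eval]
    simp only [polyPhase, map_add, map_one, map_mul, MvPolynomial.eval_X]
    cases x 0 <;> cases x 1 <;> decide

/-- **No table-based decider for the signed slice.** However the arity is used, a decider `D` that
sees a cubic pair `(f,g)` only through the two derivative Walsh tables `T_f, T_g` (the data the
Φ²-engine samples from) cannot separate `Φ ≥ 3/5` from `Φ ≤ -3/5`: already at `n = 2` the cubic pairs
`(x₀x₁, x₀x₁)` (`Φ = 1`) and `(x₀x₁, ¬(x₀x₁))` (`Φ = -1`) have identical tables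
(tree: `dwt_signOf_not`, `forrelation_not_right`). [folklore] -/
theorem signed_slice_defeats_table_deciders :
    ¬ ∃ D : (n : ℕ) → ((Fin n → Bool) → (Fin n → Bool) → ℝ) → ((Fin n → Bool) → (Fin n → Bool) → ℝ) → Bool,
      ∀ (n : ℕ) (f g : (Fin n → Bool) → Bool), IsDegLeFun 3 f → IsDegLeFun 3 g →
        ((3 : ℝ) / 5 ≤ forrelation f g →
            D n (dwt fun x => signOf (f x)) (dwt fun y => signOf (g y)) = true) ∧
        (forrelation f g ≤ -(3 : ℝ) / 5 →
            D n (dwt fun x => signOf (f x)) (dwt fun y => signOf (g y)) = false) := by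
  rintro ⟨D, hD⟩
  have hdeg : IsDegLeFun 3 andTwoCircuit.eval := isDegLeFun_andTwoCircuit_eval
  have hyes := (hD 2 andTwoCircuit.eval andTwoCircuit.eval hdeg hdeg).1
    (by rw [forrelation_and_and]; norm_num)
  have hno := (hD 2 andTwoCircuit.eval (fun y => !(andTwoCircuit.eval y)) hdeg isDegLeFun_not_and).2
    (by rw [forrelation_not_right, forrelation_and_and]; norm_num)
  have htab : (dwt fun y => signOf (!(andTwoCircuit.eval y))) = dwt fun y => signOf (andTwoCircuit.eval y) := by
    funext h u
    exact dwt_signOf_not _ h u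
  rw [htab, hyes] at hno
  exact Bool.noConfusion hno


end Summit.QuantumAdvantage.QuantumAdvantage.Theorems.CubicForrelationInPrBPP.Negative

end
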